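import Summits.BirchSwinnertonDyer.BirchSwinnertonDyer.Theorems.KimAtThreeDeepLowerOffStratumSockets
import Summits.BirchSwinnertonDyer.BirchSwinnertonDyer.Theorems.KimAtThreeDeepUpperOffStratumWuthrich
import HarnessLib

/-!
# Route `KimAtThreeKolyvagin` (rung W2), crux `DeepLowerAtThreeOffKatoStratum` (item 19679), registered stub
# `stub_nonAdditive`: what the stub COSTS — given Wuthrich 2014 Prop. 21 (Kato's bound, by name) the stub
# IMPLIES «Tamagawa divisibility of deep Kurihara numbers» on every one of its rows, and together with the
# upper twin's residue (DD) it IMPLIES the lower half of `BSD₃` on the whole non-additive tower stratum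
# (good SUPERSINGULAR `3` and multiplicative `3` without (ram) included)

Cell `bsd-addord`, seat `bsd-addord-w2-acc2` (PROGRAMME PART 1b, ACCEL-LIST row (2)), item
`stmt-BirchSwinnertonDyer-19679` (BC3 skeleton sha16 `e575d03075635394`). Sequel of
`KimAtThreeDeepLowerOffStratumSockets` / `KimAtThreeDeepLowerOffStratumNonAdditiveRows` (this seat: the
stub ⟸ Miller's lower half ∧ TamDiv-deep, by name on rows C1 ∪ C16). Theorems only; every printed input
is a hypothesis BY NAME; the registered stub enters as a DISPLAYED hypothesis (its signature verbatim);
nothing asserted; the crux stays OPEN.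

Notation at a row: `a = ∂⁽⁰⁾(δ̃)`, `d = ∂^{(∞)}_{deep}(δ̃)`, `s = ord₃ #Ш(E/ℚ)(3)`, `c = v₃(∏ c_ℓ)`; the stub's
row conclusion is `a ≤ s + d`. THE POINT: Miller's UPPER half `s + c ≤ a` is IN PRINT on EVERY non-additive
tower row of analytic rank `0` — Wuthrich 2014 Prop. 21 (Kato's bound made Tamagawa-exact; tree fact
`Wuthrich2014.sha_dvd_analyticSha`, w2-c5's `missingUpperBoundAt_three_of_not_addv_of_towerSurj`) — and it
reaches `∂⁽⁰⁾` at ANY lattice-optimal datum Manin-free (w2-c5's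
`sha_add_tamagawa_le_kuriharaPartial_zero_of_missingUpperBoundAt_of_optimal`). Hence:

* §1 `tamagawa_le_deepInfty_of_lowerRow_of_missingUpperBoundAt_of_optimal` (odd `p`, pure bookkeeping):
  upper half ∧ (stub's row conclusion) ⟹ TamDiv-deep `c ≤ d`, at any lattice-optimal datum, no period
  hypothesis; `tamagawa_le_deepInfty_of_lowerRow_of_wuthrich` (`p = 3`): the same from Wuthrich Prop. 21
  (`hW`), GZK, modularity on every NON-ADDITIVE tower row.
* §2 ★ `tamDivDeep_of_stub_nonAdditive_of_wuthrich`: the registered stub (signature VERBATIM, as a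
  hypothesis) IMPLIES, given `hW`, `hGZK`, `hmod`, TamDiv-deep `v₃(∏ c_ℓ) ≤ ∂^{(∞)}_{deep}(δ̃)` on EVERY one of
  its rows — Kim 2022 Conj. 1.10's `≥` half (deep reading) at `p = 3` on all non-additive tower rows of
  analytic rank `0`. With `stub_nonAdditive_covered_of_tamagawa_le_deepInfty` (companion file): on rows
  C1 ∪ C16 the stub is EQUIVALENT to TamDiv-deep modulo named print; off them it is at least as strong.
* §3 ★ `missingLowerBoundAt_of_stub_nonAdditive_of_deepInfty_le_tamagawa`: the registered stub ∧ the
  upper twin's typed residue (DD) `∂^{(∞)}_{deep} ≤ v₃(∏ c_ℓ)` at a row (w2-c5, item 19562) IMPLY Miller's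
  LOWER half `MissingLowerBoundAt W₀ 3` at that row (Mazur Cor. 4.1 `hM` for the period transfer, GZK) —
  on good SUPERSINGULAR `3` rows this is the signed-main-conjecture lower bound of corners X6/X7/X8 at
  `p = 3`, on multiplicative `3` without (ram) it is corner X11a's missing input at `3`: the off-stratum
  deep pair {19679, 19562} on its non-additive rows is CORNER-HARD, not bookkeeping.
[cite: Wuthrich2014, Prop. 21 (p. 400)] [cite: Miller2011LMS, Def. 1.1] [cite: Mazur1978, Cor. 4.1]
[cite: Kim2022StructureSelmer, §1.5.1, Conj. 1.10 (PDF pp. 7–8), Thm. 1.9 (6)] [cite: Kim2025RefinedTNC, Thm. 1.1]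
[cite: MazurRubin2004, Def. 5.2.11, Thm. 5.2.12]
-/

set_option autoImplicit false
-- the Theorems namespace of a single-conjunct summit repeats the summit name by design (D-0017)
set_option linter.dupNamespace false

noncomputable section

open scoped MatrixGroups ModularForm Classical

open CongruenceSubgroup WeierstrassCurve Literature.NumberTheory.EllipticCurves
  Literature.NumberTheory.EllipticCurves.ModularForms
  Literature.NumberTheory.EllipticCurves.Rank1Residual
  Literature.NumberTheory.EllipticCurves.Rank1Residual.Typed
  Literature.NumberTheory.EllipticCurves.Wuthrich2014

namespace Summit.BirchSwinnertonDyer.BirchSwinnertonDyer.Theorems.KimAtThreeDeepLowerOffStratumWuthrich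

open Summit.BirchSwinnertonDyer.Rank1Residual
open Summit.BirchSwinnertonDyer.BirchSwinnertonDyer.Theses.KimAtThreeKolyvagin
open Summit.BirchSwinnertonDyer.BirchSwinnertonDyer.Theorems.KimAtThreeKolyvaginUnitLevelOneRungs
open Summit.BirchSwinnertonDyer.BirchSwinnertonDyer.Theorems.KimAtThreeDeepUpperDefectObstruction
open Summit.BirchSwinnertonDyer.BirchSwinnertonDyer.Theorems.KimAtThreeDeepLowerSmallDefect
open Summit.BirchSwinnertonDyer.BirchSwinnertonDyer.Theorems.KimAtThreeDeepLowerNonAdditiveRows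
open Summit.BirchSwinnertonDyer.BirchSwinnertonDyer.Theorems.KimAtThreeShallowEqDeepOffStratumNonAdditiveRows
open Summit.BirchSwinnertonDyer.BirchSwinnertonDyer.Theorems.KimAtThreeDeepUpperOffStratumManinFree
open Summit.BirchSwinnertonDyer.BirchSwinnertonDyer.Theorems.KimAtThreeDeepUpperOffStratumWuthrich
open Summit.BirchSwinnertonDyer.BirchSwinnertonDyer.Theorems.KimAtThreeDeepLowerOffStratumSockets

/-! ### §1 Upper half ∧ the stub's row conclusion ⟹ TamDiv-deep (Manin-free) -/

section Optimal

variable (W : WeierstrassCurve ℚ) [W.IsElliptic] [W.IsGloballyMinimal] (p : ℕ) [Fact p.Prime]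
  {N : ℕ} [NeZero N]

/-- **Upper half ∧ LOWER row conclusion ⟹ TamDiv-deep, at any lattice-optimal datum** (odd `p`, `E[p]`
irreducible, analytic rank `0`, GZK; NO period hypothesis): w2-c5's Manin-free bridge gives
`s + c ≤ ∂⁽⁰⁾`; with `∂⁽⁰⁾ ≤ s + d` this is `c ≤ d`. [cite: Miller2011LMS, Def. 1.1]
[cite: Kim2022StructureSelmer, Conj. 1.10 (PDF p. 8), §1.5.1 (PDF p. 7)] -/
theorem tamagawa_le_deepInfty_of_lowerRow_of_missingUpperBoundAt_of_optimal
    (hGZK : rank_eq_analyticRank_of_analyticRank_le_one) (hp2 : p ≠ 2)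
    (hirr : W.HasIrreducibleModPGaloisRep p) (D : ModularParametrizationData W N)
    (hopt : ∀ z ∈ D.L.lattice, ∃ w ∈ periodLattice D.f, z = D.c * w)
    (hord : kuriharaVanishingOrder W p D.f = 0) (hup : MissingUpperBoundAt W p)
    (hL : ∃ d : ℕ, kuriharaPartialDeepInfty W p D.f = d ∧
      kuriharaPartial W p D.f 0 ≤
        ((padicValNat p (Nat.card (AddCommGroup.primaryComponent W.sha p)) + d : ℕ) : ℕ∞)) :
    ((padicValNat p W.tamagawaProduct : ℕ) : ℕ∞) ≤ kuriharaPartialDeepInfty W p D.f := by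
  obtain ⟨d, hd, hle⟩ := hL
  have h := (sha_add_tamagawa_le_kuriharaPartial_zero_of_missingUpperBoundAt_of_optimal W p hGZK hp2
    hirr D hopt hord hup).trans hle
  rw [hd]
  have h' : padicValNat p (Nat.card (AddCommGroup.primaryComponent W.sha p)) +
      padicValNat p W.tamagawaProduct ≤
      padicValNat p (Nat.card (AddCommGroup.primaryComponent W.sha p)) + d := by exact_mod_cast h
  exact_mod_cast Nat.le_of_add_le_add_left h'

end Optimal

/-- **On EVERY non-additive tower row of analytic rank `0` (good ordinary, good SUPERSINGULAR,
multiplicative with or without (ram)), the stub's row conclusion at a lattice-optimal datum IMPLIES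
TamDiv-deep** — Wuthrich 2014 Prop. 21 (`hW`), GZK (`hGZK`), modularity (`hmod`) give the upper half
(w2-c5's `missingUpperBoundAt_three_of_not_addv_of_towerSurj`), then §1. [cite: Wuthrich2014, Prop. 21 (p. 400)]
[cite: Kim2022StructureSelmer, Conj. 1.10 (PDF p. 8)] -/
theorem tamagawa_le_deepInfty_of_lowerRow_of_wuthrich (hW : sha_dvd_analyticSha)
    (hGZK : rank_eq_analyticRank_of_analyticRank_le_one) (hmod : hasEntireLFunction_rat)
    (W₀ : WeierstrassCurve ℚ) [W₀.IsElliptic] [W₀.IsGloballyMinimal]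
    (htower : ∀ n : ℕ, W₀.HasSurjectiveModNGaloisRep (3 ^ n : ℕ))
    {N : ℕ} [NeZero N] (D₀ : ModularParametrizationData W₀ N)
    (hopt : ∀ z ∈ D₀.L.lattice, ∃ w ∈ periodLattice D₀.f, z = D₀.c * w)
    (hord : kuriharaVanishingOrder W₀ 3 D₀.f = 0)
    (hnA : ¬ (haveI : Fact (Nat.Prime 3) := ⟨Nat.prime_three⟩; Addv W₀ 3))
    (hrow : ∃ d : ℕ, kuriharaPartialDeepInfty W₀ 3 D₀.f = d ∧
      kuriharaPartial W₀ 3 D₀.f 0 ≤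
        ((padicValNat 3 (Nat.card (AddCommGroup.primaryComponent W₀.sha 3)) + d : ℕ) : ℕ∞)) :
    ((padicValNat 3 W₀.tamagawaProduct : ℕ) : ℕ∞) ≤ kuriharaPartialDeepInfty W₀ 3 D₀.f := by
  haveI : Fact (Nat.Prime 3) := ⟨Nat.prime_three⟩
  have hr0 : W₀.analyticRank = 0 :=
    analyticRank_eq_zero_of_kuriharaVanishingOrder_eq_zero W₀ D₀.f D₀.isNewformOf hord
  exact tamagawa_le_deepInfty_of_lowerRow_of_missingUpperBoundAt_of_optimal W₀ 3 hGZK (by norm_num)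
    (hasIrreducibleModPGaloisRep_of_hasSurjectiveModNGaloisRep W₀ 3 (by simpa using htower 1)) D₀ hopt
    hord (missingUpperBoundAt_three_of_not_addv_of_towerSurj hW hGZK hmod W₀ htower hr0 hnA) hrow

/-! ### §2 What the registered stub IMPLIES: TamDiv-deep on every one of its rows -/

/-- ★ **The registered stub `stub_nonAdditive` of crux 19679 (signature VERBATIM, as a hypothesis)
IMPLIES, given Wuthrich 2014 Prop. 21 (`hW`), GZK (`hGZK`) and modularity (`hmod`), «Tamagawa
divisibility of deep Kurihara numbers» `v₃(∏ c_ℓ) ≤ ∂^{(∞)}_{deep}(δ̃)` on every one of its rows** (binders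
verbatim): Kim 2022 Conj. 1.10, `≥` half, deep reading, at `p = 3` on all non-additive tower rows of
analytic rank `0` at the optimal datum. So a kernel proof of the stub is, modulo print, a proof of that
conjecture-half there; with the companion file's `stub_nonAdditive_covered_of_tamagawa_le_deepInfty` the
stub and TamDiv-deep are EQUIVALENT modulo named print on rows C1 ∪ C16.
[cite: Wuthrich2014, Prop. 21 (p. 400)] [cite: Kim2022StructureSelmer, Conj. 1.10 (PDF p. 8), Thm. 1.9 (6)]
[cite: Kim2025RefinedTNC, Thm. 1.1] -/
theorem tamDivDeep_of_stub_nonAdditive_of_wuthrich (hW : sha_dvd_analyticSha)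
    (hGZK : rank_eq_analyticRank_of_analyticRank_le_one) (hmod : hasEntireLFunction_rat)
    (hstub : ∀ (W₀ : WeierstrassCurve ℚ) [W₀.IsElliptic] [W₀.IsGloballyMinimal],
      (∀ n : ℕ, W₀.HasSurjectiveModNGaloisRep (3 ^ n : ℕ)) → Finite W₀.sha →
      ∀ {N : ℕ} [NeZero N], N = W₀.conductorNorm ℤ →
      ∀ (D₀ : ModularParametrizationData W₀ N),
        (∀ z ∈ D₀.L.lattice, ∃ w ∈ periodLattice D₀.f, z = D₀.c * w) →
        (∀ (W₂ : WeierstrassCurve ℚ) [W₂.IsElliptic] (D₂ : ModularParametrizationData W₂ N),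
          D₂.f = D₀.f → D₀.modularDegree ≤ D₂.modularDegree) →
        (∀ r : ℚ, ratPlusSymbol D₀.f r ≠ 0 → 0 ≤ padicValRat 3 (ratPlusSymbol D₀.f r)) →
        kuriharaVanishingOrder W₀ 3 D₀.f = 0 →
        ¬ (haveI : Fact (Nat.Prime 3) := ⟨Nat.prime_three⟩; Addv W₀ 3) →
        ∃ d : ℕ, kuriharaPartialDeepInfty W₀ 3 D₀.f = d ∧
          kuriharaPartial W₀ 3 D₀.f 0 ≤
            ((padicValNat 3 (Nat.card (AddCommGroup.primaryComponent W₀.sha 3)) + d : ℕ) : ℕ∞)) :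
    ∀ (W₀ : WeierstrassCurve ℚ) [W₀.IsElliptic] [W₀.IsGloballyMinimal],
      (∀ n : ℕ, W₀.HasSurjectiveModNGaloisRep (3 ^ n : ℕ)) → Finite W₀.sha →
      ∀ {N : ℕ} [NeZero N], N = W₀.conductorNorm ℤ →
      ∀ (D₀ : ModularParametrizationData W₀ N),
        (∀ z ∈ D₀.L.lattice, ∃ w ∈ periodLattice D₀.f, z = D₀.c * w) →
        (∀ (W₂ : WeierstrassCurve ℚ) [W₂.IsElliptic] (D₂ : ModularParametrizationData W₂ N),
          D₂.f = D₀.f → D₀.modularDegree ≤ D₂.modularDegree) →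
        (∀ r : ℚ, ratPlusSymbol D₀.f r ≠ 0 → 0 ≤ padicValRat 3 (ratPlusSymbol D₀.f r)) →
        kuriharaVanishingOrder W₀ 3 D₀.f = 0 →
        ¬ (haveI : Fact (Nat.Prime 3) := ⟨Nat.prime_three⟩; Addv W₀ 3) →
        ((padicValNat 3 W₀.tamagawaProduct : ℕ) : ℕ∞) ≤ kuriharaPartialDeepInfty W₀ 3 D₀.f := by
  intro W₀ _ _ htower hfin N _ hN D₀ hopt hdeg hint hord hnA
  exact tamagawa_le_deepInfty_of_lowerRow_of_wuthrich hW hGZK hmod W₀ htower D₀ hopt hord hnA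
    (hstub W₀ htower hfin hN D₀ hopt hdeg hint hord hnA)

/-! ### §3 What the registered stub and the upper twin's residue BUY: the lower half of `BSD₃` -/

/-- ★ **The registered stub `stub_nonAdditive` of crux 19679 (VERBATIM, as a hypothesis) together with the
upper twin's typed residue (DD) `∂^{(∞)}_{deep}(δ̃) ≤ v₃(∏ c_ℓ)` at a row (item 19562, w2-c5) IMPLIES Miller's
LOWER half `MissingLowerBoundAt W₀ 3` (`ord₃ #Ш_an ≤ ord₃ #Ш`) at that row** — for EVERY non-additive tower
row of analytic rank `0` at the optimal datum of conductor level (Mazur 1978 Cor. 4.1 `hM` for the `3`-adic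
period transfer, GZK): `a ≤ s + d ≤ s + c`, then w2-c3's `missingLowerBoundAt_of_kuriharaPartial_zero_le`.
On good SUPERSINGULAR `3` rows this conclusion is the signed-main-conjecture lower bound behind corners
X6/X7/X8 of the partition at `p = 3`; on multiplicative `3` rows without (ram) it is corner X11a's missing
input at `3`. So the off-stratum deep pair {19679 lower, 19562 upper} on its non-additive rows is
CORNER-HARD. [cite: Mazur1978, Cor. 4.1] [cite: Miller2011LMS, Def. 1.1]
[cite: Kim2022StructureSelmer, Conj. 1.10 (PDF p. 8), Thm. 1.9 (6)] [cite: Kim2025RefinedTNC, Thm. 1.1] -/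
theorem missingLowerBoundAt_of_stub_nonAdditive_of_deepInfty_le_tamagawa
    (hM : mazur_not_dvd_maninConstant_of_odd) (hGZK : rank_eq_analyticRank_of_analyticRank_le_one)
    (hstub : ∀ (W₀ : WeierstrassCurve ℚ) [W₀.IsElliptic] [W₀.IsGloballyMinimal],
      (∀ n : ℕ, W₀.HasSurjectiveModNGaloisRep (3 ^ n : ℕ)) → Finite W₀.sha →
      ∀ {N : ℕ} [NeZero N], N = W₀.conductorNorm ℤ →
      ∀ (D₀ : ModularParametrizationData W₀ N),
        (∀ z ∈ D₀.L.lattice, ∃ w ∈ periodLattice D₀.f, z = D₀.c * w) →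
        (∀ (W₂ : WeierstrassCurve ℚ) [W₂.IsElliptic] (D₂ : ModularParametrizationData W₂ N),
          D₂.f = D₀.f → D₀.modularDegree ≤ D₂.modularDegree) →
        (∀ r : ℚ, ratPlusSymbol D₀.f r ≠ 0 → 0 ≤ padicValRat 3 (ratPlusSymbol D₀.f r)) →
        kuriharaVanishingOrder W₀ 3 D₀.f = 0 →
        ¬ (haveI : Fact (Nat.Prime 3) := ⟨Nat.prime_three⟩; Addv W₀ 3) →
        ∃ d : ℕ, kuriharaPartialDeepInfty W₀ 3 D₀.f = d ∧
          kuriharaPartial W₀ 3 D₀.f 0 ≤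
            ((padicValNat 3 (Nat.card (AddCommGroup.primaryComponent W₀.sha 3)) + d : ℕ) : ℕ∞))
    (W₀ : WeierstrassCurve ℚ) [W₀.IsElliptic] [W₀.IsGloballyMinimal]
    (htower : ∀ n : ℕ, W₀.HasSurjectiveModNGaloisRep (3 ^ n : ℕ)) (hfin : Finite W₀.sha)
    {N : ℕ} [NeZero N] (hN : N = W₀.conductorNorm ℤ) (D₀ : ModularParametrizationData W₀ N)
    (hopt : ∀ z ∈ D₀.L.lattice, ∃ w ∈ periodLattice D₀.f, z = D₀.c * w)
    (hdeg : ∀ (W₂ : WeierstrassCurve ℚ) [W₂.IsElliptic] (D₂ : ModularParametrizationData W₂ N),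
      D₂.f = D₀.f → D₀.modularDegree ≤ D₂.modularDegree)
    (hint : ∀ r : ℚ, ratPlusSymbol D₀.f r ≠ 0 → 0 ≤ padicValRat 3 (ratPlusSymbol D₀.f r))
    (hord : kuriharaVanishingOrder W₀ 3 D₀.f = 0)
    (hnA : ¬ (haveI : Fact (Nat.Prime 3) := ⟨Nat.prime_three⟩; Addv W₀ 3))
    (hDD : kuriharaPartialDeepInfty W₀ 3 D₀.f ≤ ((padicValNat 3 W₀.tamagawaProduct : ℕ) : ℕ∞)) :
    MissingLowerBoundAt W₀ 3 := by
  haveI : Fact (Nat.Prime 3) := ⟨Nat.prime_three⟩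
  obtain ⟨d, hd, hle⟩ := hstub W₀ htower hfin hN D₀ hopt hdeg hint hord hnA
  exact missingLowerBoundAt_of_kuriharaPartial_zero_le W₀ 3 D₀.f hGZK (by norm_num)
    (hasIrreducibleModPGaloisRep_of_hasSurjectiveModNGaloisRep W₀ 3 (by simpa using htower 1))
    D₀.isNewformOf hord (periodTransfer_three_of_optimal_of_not_addv W₀ hM hN D₀ hopt hnA)
    (kuriharaPartial_zero_le_of_deepDefectLe_of_lower W₀ 3 D₀.f hd hle hDD)

/-- **Row form of §3 without the stub as a global hypothesis**: at ONE non-additive tower row of analytic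
rank `0` (optimal datum at the conductor), the LOWER row conclusion ∧ (DD) at the row ⟹
`MissingLowerBoundAt W₀ 3`. [cite: Mazur1978, Cor. 4.1] [cite: Miller2011LMS, Def. 1.1]
[cite: Kim2022StructureSelmer, Conj. 1.10 (PDF p. 8)] -/
theorem missingLowerBoundAt_of_lowerRow_of_deepInfty_le_tamagawa
    (hM : mazur_not_dvd_maninConstant_of_odd) (hGZK : rank_eq_analyticRank_of_analyticRank_le_one)
    (W₀ : WeierstrassCurve ℚ) [W₀.IsElliptic] [W₀.IsGloballyMinimal]
    (htower : ∀ n : ℕ, W₀.HasSurjectiveModNGaloisRep (3 ^ n : ℕ))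
    {N : ℕ} [NeZero N] (hN : N = W₀.conductorNorm ℤ) (D₀ : ModularParametrizationData W₀ N)
    (hopt : ∀ z ∈ D₀.L.lattice, ∃ w ∈ periodLattice D₀.f, z = D₀.c * w)
    (hord : kuriharaVanishingOrder W₀ 3 D₀.f = 0)
    (hnA : ¬ (haveI : Fact (Nat.Prime 3) := ⟨Nat.prime_three⟩; Addv W₀ 3))
    (hrow : ∃ d : ℕ, kuriharaPartialDeepInfty W₀ 3 D₀.f = d ∧
      kuriharaPartial W₀ 3 D₀.f 0 ≤
        ((padicValNat 3 (Nat.card (AddCommGroup.primaryComponent W₀.sha 3)) + d : ℕ) : ℕ∞))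
    (hDD : kuriharaPartialDeepInfty W₀ 3 D₀.f ≤ ((padicValNat 3 W₀.tamagawaProduct : ℕ) : ℕ∞)) :
    MissingLowerBoundAt W₀ 3 := by
  haveI : Fact (Nat.Prime 3) := ⟨Nat.prime_three⟩
  obtain ⟨d, hd, hle⟩ := hrow
  exact missingLowerBoundAt_of_kuriharaPartial_zero_le W₀ 3 D₀.f hGZK (by norm_num)
    (hasIrreducibleModPGaloisRep_of_hasSurjectiveModNGaloisRep W₀ 3 (by simpa using htower 1))
    D₀.isNewformOf hord (periodTransfer_three_of_optimal_of_not_addv W₀ hM hN D₀ hopt hnA)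
    (kuriharaPartial_zero_le_of_deepDefectLe_of_lower W₀ 3 D₀.f hd hle hDD)

/-- **… hence full `BSD(E,3)` at such a row from the two off-stratum row conclusions**: LOWER row
conclusion ∧ (DD) ⟹ lower half (previous theorem); Wuthrich Prop. 21 ⟹ upper half; GZK ⟹ `BSDp W₀ 3`
(`bsdp_of_missingPPartAt`). On good-supersingular-`3` / multiplicative-without-(ram) tower rows of analytic
rank `0` this would DELETE a summit corner at `3` — a measure of what the deep pair asks.
[cite: Wuthrich2014, Prop. 21 (p. 400)] [cite: Miller2011LMS, §1 and Def. 1.1] [cite: Mazur1978, Cor. 4.1] -/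
theorem bsdp_three_of_lowerRow_of_deepInfty_le_tamagawa_of_wuthrich (hW : sha_dvd_analyticSha)
    (hM : mazur_not_dvd_maninConstant_of_odd) (hGZK : rank_eq_analyticRank_of_analyticRank_le_one)
    (hmod : hasEntireLFunction_rat)
    (W₀ : WeierstrassCurve ℚ) [W₀.IsElliptic] [W₀.IsGloballyMinimal]
    (htower : ∀ n : ℕ, W₀.HasSurjectiveModNGaloisRep (3 ^ n : ℕ))
    {N : ℕ} [NeZero N] (hN : N = W₀.conductorNorm ℤ) (D₀ : ModularParametrizationData W₀ N)
    (hopt : ∀ z ∈ D₀.L.lattice, ∃ w ∈ periodLattice D₀.f, z = D₀.c * w)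
    (hord : kuriharaVanishingOrder W₀ 3 D₀.f = 0)
    (hnA : ¬ (haveI : Fact (Nat.Prime 3) := ⟨Nat.prime_three⟩; Addv W₀ 3))
    (hrow : ∃ d : ℕ, kuriharaPartialDeepInfty W₀ 3 D₀.f = d ∧
      kuriharaPartial W₀ 3 D₀.f 0 ≤
        ((padicValNat 3 (Nat.card (AddCommGroup.primaryComponent W₀.sha 3)) + d : ℕ) : ℕ∞))
    (hDD : kuriharaPartialDeepInfty W₀ 3 D₀.f ≤ ((padicValNat 3 W₀.tamagawaProduct : ℕ) : ℕ∞)) :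
    haveI : Fact (Nat.Prime 3) := ⟨Nat.prime_three⟩; BSDp W₀ 3 := by
  haveI : Fact (Nat.Prime 3) := ⟨Nat.prime_three⟩
  have hr0 : W₀.analyticRank = 0 :=
    analyticRank_eq_zero_of_kuriharaVanishingOrder_eq_zero W₀ D₀.f D₀.isNewformOf hord
  exact bsdp_of_missingPPartAt W₀ 3 hGZK (by rw [hr0]; exact zero_le_one)
    (missingPPartAt_of_lower_of_upper W₀ 3
      (missingLowerBoundAt_of_lowerRow_of_deepInfty_le_tamagawa hM hGZK W₀ htower hN D₀ hopt hord hnA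
        hrow hDD)
      (missingUpperBoundAt_three_of_not_addv_of_towerSurj hW hGZK hmod W₀ htower hr0 hnA))

end Summit.BirchSwinnertonDyer.BirchSwinnertonDyer.Theorems.KimAtThreeDeepLowerOffStratumWuthrich

end
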